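import Summits.CriticalPhenomena.PercolationContinuityZ3.Theorems.PercNearOneGluingNoHeavyLowerTailSunflowerRainbowReadingVectors
import HarnessLib
import HarnessLib.Audit

/-!
# `NoHeavyLowerTail` (crux stmt-CriticalPhenomena-4575), abstract sunflower cubic: the COMPLEMENT READING LEMMA for the
# `(1|4)` kernel vectors of the GF(2) programme (part 1 of 2 of gen 20; part 2 `…SunflowerRainbowIntersecting`)

Support file (seat `prim-l12-p2` gen 20; `--supports stmt-CriticalPhenomena-4575`).  No `sorry`, no new definitions.
Memo: run/shared/lean/prim/prim-l12/prim-l12-p2/FINDING-g20-COMPLEMENT-READING.md.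

Setting: parts A/B of gen 18 (`…SunflowerRainbowVectors`, `…SunflowerRainbowReduction`): the two-stage rainbow vectors
`rbVec ρ ∈ GF(2)^{sup}`; their bottom-cube parts are multiples of the `(1|4)` kernel vectors `ν_P = (#{R ∈ A : P ⊆ R ⊆ W∖O})_O`
of the cubes `W = Sᶜ` (`lab P = 1`, `lab (W∖P) = 4`).

* `Sunflower.nu_read_compl` — **COMPLEMENT READING LEMMA** (cube level).  For `(1|4)`-type sets `P, P'` of a cube `W`
  (`lab P = lab P' = 1`, `lab (W∖P') ≠ 0`), the `M`-row functional of the KERNEL set `W ∖ P` reads `ν_{P'}` as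
  `Σ_O #{R' ∈ B : O ⊆ R' ⊆ W∖P}·#{R ∈ A : P' ⊆ R ⊆ W∖O} ≡ #{S : lab S = 1, P' ⊆ S ⊆ P} = [P = P']  (mod 2)`
  provided NO label-1 set lies inside `W ∖ P` ("no rival of `P` in the cube").  Without the proviso the value is
  `#{(S,R') : lab S = 1, P' ⊆ S ⊆ W, lab R' = 0, R' ⊆ S∖P}` (memo §2: the defect counts rival petal-1 sets); in particular the
  `(1|4)` vectors of a cube whose `(1|4)` sets pairwise meet are linearly independent (memo §1, census) and have this explicit dual.
* `Sunflower.rbVec_read_compl` — the same functional placed at a bottom spectator `S` reads `rbVec ρ` as `m_ρ(S)·[P' = Q1]`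
  (`m_ρ(S) = #{R' ∈ B : S ⊆ R' ⊆ Q3}` the TS-B coefficient).
Part 2 assembles the explicit left inverse of the rainbow vectors for an intersecting petal 1.
-/

namespace Summit.CriticalPhenomena.PercolationContinuityZ3.Theorems.SunflowerPartition

open Finset

namespace Sunflower

variable {α : Type*} [Fintype α] [DecidableEq α] (F : Sunflower α)

/-! ## The complement reading lemma (cube level) -/

omit [Fintype α] in
/-- **COMPLEMENT READING LEMMA** (this work).  For `P, P' ⊆ W` with `lab P = lab P' = 1`, `lab (W ∖ P') ≠ 0`, and no label-1 set inside
`W ∖ P`:  `Σ_{O ⊆ W} #{R' ∈ B : O ⊆ R' ⊆ W∖P} · #{R ∈ A : P' ⊆ R ⊆ W∖O} ≡ [P = P'] (mod 2)`. [this work] -/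
theorem nu_read_compl (W : Finset α) {P P' : Finset α} (hP : P ⊆ W)
    (hP1 : F.lab P = 1) (hP'1 : F.lab P' = 1) (hcP' : F.lab (W \ P') ≠ 0)
    (hriv : ∀ D, D ⊆ W \ P → F.lab D ≠ 1) :
    (∑ O ∈ W.powerset,
        (∑ R' ∈ W.powerset, (if F.lab R' = 0 ∧ O ⊆ R' ∧ R' ⊆ W \ P then (1 : ZMod 2) else 0)) *
        (∑ R ∈ W.powerset, (if F.lab R = 4 ∧ P' ⊆ R ∧ R ⊆ W \ O then (1 : ZMod 2) else 0)))
      = if P = P' then 1 else 0 := by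
  have hc0 : F.lab P' ≠ 0 := by rw [hP'1]; decide
  have hc4 : F.lab P' ≠ 4 := by rw [hP'1]; decide
  -- (b) expand and do the `O`-sum first: `#{O ⊆ R' ∖ R} ≡ [R' ⊆ R]`
  have hO : ∀ R' ∈ W.powerset, ∀ R ∈ W.powerset,
      (∑ O ∈ W.powerset, ((if F.lab R' = 0 ∧ O ⊆ R' ∧ R' ⊆ W \ P then (1 : ZMod 2) else 0) *
        (if F.lab R = 4 ∧ P' ⊆ R ∧ R ⊆ W \ O then (1 : ZMod 2) else 0)))
        = if F.lab R' = 0 ∧ R' ⊆ W \ P ∧ F.lab R = 4 ∧ P' ⊆ R ∧ R' ⊆ R then 1 else 0 := by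
    intro R' hR' R hR
    have hR'W : R' ⊆ W := mem_powerset.1 hR'
    have hRW : R ⊆ W := mem_powerset.1 hR
    by_cases h1 : F.lab R' = 0 ∧ R' ⊆ W \ P ∧ F.lab R = 4 ∧ P' ⊆ R
    · rw [show (if F.lab R' = 0 ∧ R' ⊆ W \ P ∧ F.lab R = 4 ∧ P' ⊆ R ∧ R' ⊆ R then (1 : ZMod 2) else 0)
          = if (∅ : Finset α) = R' \ R then 1 else 0 by
        by_cases h2 : R' ⊆ R
        · rw [if_pos ⟨h1.1, h1.2.1, h1.2.2.1, h1.2.2.2, h2⟩, if_pos (Finset.sdiff_eq_empty_iff_subset.2 h2).symm]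
        · rw [if_neg fun h => h2 h.2.2.2.2, if_neg fun h => h2 (Finset.sdiff_eq_empty_iff_subset.1 h.symm)]]
      rw [← HallGladkov.sum_powerset_ite_Icc (A := ∅) (B := R' \ R) (W := W) (sdiff_subset.trans hR'W)]
      refine sum_congr rfl fun O hO => ?_
      have hOW : O ⊆ W := mem_powerset.1 hO
      simp only [ite_zero_mul_ite_zero, one_mul]
      by_cases h3 : O ⊆ R' \ R
      · rw [if_pos (show (∅ : Finset α) ⊆ O ∧ O ⊆ R' \ R from ⟨empty_subset _, h3⟩),
          if_pos (show (F.lab R' = 0 ∧ O ⊆ R' ∧ R' ⊆ W \ P) ∧ F.lab R = 4 ∧ P' ⊆ R ∧ R ⊆ W \ O from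
            ⟨⟨h1.1, h3.trans sdiff_subset, h1.2.1⟩, h1.2.2.1, h1.2.2.2,
              fun x hx => mem_sdiff.2 ⟨hRW hx, fun hxO => (mem_sdiff.1 (h3 hxO)).2 hx⟩⟩)]
      · rw [if_neg (show ¬ ((∅ : Finset α) ⊆ O ∧ O ⊆ R' \ R) from fun h => h3 h.2),
          if_neg (show ¬ ((F.lab R' = 0 ∧ O ⊆ R' ∧ R' ⊆ W \ P) ∧ F.lab R = 4 ∧ P' ⊆ R ∧ R ⊆ W \ O) from
            fun h => h3 fun x hx => mem_sdiff.2 ⟨h.1.2.1 hx, fun hxR => (mem_sdiff.1 (h.2.2.2 hxR)).2 hx⟩)]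
    · rw [if_neg fun h => h1 ⟨h.1, h.2.1, h.2.2.1, h.2.2.2.1⟩]
      refine sum_eq_zero fun O _ => ?_
      rw [ite_zero_mul_ite_zero, if_neg]
      rintro ⟨⟨h0, -, hY'⟩, h4, hs, -⟩
      exact h1 ⟨h0, hY', h4, hs⟩
  rw [show (∑ O ∈ W.powerset,
        (∑ R' ∈ W.powerset, (if F.lab R' = 0 ∧ O ⊆ R' ∧ R' ⊆ W \ P then (1 : ZMod 2) else 0)) *
        (∑ R ∈ W.powerset, (if F.lab R = 4 ∧ P' ⊆ R ∧ R ⊆ W \ O then (1 : ZMod 2) else 0)))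
      = ∑ R' ∈ W.powerset, ∑ R ∈ W.powerset,
          (if F.lab R' = 0 ∧ R' ⊆ W \ P ∧ F.lab R = 4 ∧ P' ⊆ R ∧ R' ⊆ R then (1 : ZMod 2) else 0) by
    rw [show (∑ O ∈ W.powerset,
        (∑ R' ∈ W.powerset, (if F.lab R' = 0 ∧ O ⊆ R' ∧ R' ⊆ W \ P then (1 : ZMod 2) else 0)) *
        (∑ R ∈ W.powerset, (if F.lab R = 4 ∧ P' ⊆ R ∧ R ⊆ W \ O then (1 : ZMod 2) else 0)))
      = ∑ O ∈ W.powerset, ∑ R' ∈ W.powerset, ∑ R ∈ W.powerset,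
          ((if F.lab R' = 0 ∧ O ⊆ R' ∧ R' ⊆ W \ P then (1 : ZMod 2) else 0) *
           (if F.lab R = 4 ∧ P' ⊆ R ∧ R ⊆ W \ O then (1 : ZMod 2) else 0)) from
      sum_congr rfl fun O _ => Finset.sum_mul_sum _ _ _ _]
    rw [Finset.sum_comm]
    refine sum_congr rfl fun R' hR' => ?_
    rw [Finset.sum_comm]
    exact sum_congr rfl fun R hR => hO R' hR' R hR]
  -- (c) the `R`-sum: kernel supersets of `P' ∪ R'` ≡ label-1 supersets (their total is even, as `P' ∪ R' ≠ W`)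
  have hc : ∀ R' ∈ W.powerset, F.lab R' = 0 →
      (∑ R ∈ W.powerset, (if F.lab R = 4 ∧ P' ⊆ R ∧ R' ⊆ R then (1 : ZMod 2) else 0))
        = ∑ S ∈ W.powerset, (if F.lab S = F.lab P' ∧ P' ⊆ S ∧ R' ⊆ S then (1 : ZMod 2) else 0) := by
    intro R' hR' h0
    have hR'W : R' ⊆ W := mem_powerset.1 hR'
    have htot : (∑ R ∈ W.powerset, (if P' ∪ R' ⊆ R then (1 : ZMod 2) else 0)) = 0 := by
      rw [HallGladkov.sum_powerset_ite_superset, if_neg]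
      intro hW
      have hsub : W \ P' ⊆ R' := by
        intro x hx
        have hxW : x ∈ P' ∪ R' := hW.symm ▸ (mem_sdiff.1 hx).1
        rcases mem_union.1 hxW with h | h
        · exact absurd h (mem_sdiff.1 hx).2
        · exact h
      exact hcP' (F.lab_eq_zero_of_subset hsub h0)
    have hsplit : ∀ R ∈ W.powerset, (if P' ∪ R' ⊆ R then (1 : ZMod 2) else 0)
        = (if F.lab R = 4 ∧ P' ⊆ R ∧ R' ⊆ R then (1 : ZMod 2) else 0)
          + (if F.lab R = F.lab P' ∧ P' ⊆ R ∧ R' ⊆ R then (1 : ZMod 2) else 0) := by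
      intro R _
      by_cases h : P' ∪ R' ⊆ R
      · have h1 : P' ⊆ R := subset_union_left.trans h
        have h2 : R' ⊆ R := subset_union_right.trans h
        rw [if_pos h]
        rcases F.lab_superset h1 hc0 with hl | hl
        · rw [if_neg fun h' => hc4 (hl.symm.trans h'.1), if_pos ⟨hl, h1, h2⟩, zero_add]
        · rw [if_pos ⟨hl, h1, h2⟩, if_neg fun h' => hc4 (h'.1.symm.trans hl), add_zero]
      · rw [if_neg h, if_neg fun h' => h (union_subset h'.2.1 h'.2.2), if_neg fun h' => h (union_subset h'.2.1 h'.2.2),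
          add_zero]
    rw [sum_congr rfl hsplit, sum_add_distrib] at htot
    have key := eq_neg_of_add_eq_zero_left htot
    rw [key, ZMod.neg_eq_self_mod_two]
  rw [show (∑ R' ∈ W.powerset, ∑ R ∈ W.powerset,
          (if F.lab R' = 0 ∧ R' ⊆ W \ P ∧ F.lab R = 4 ∧ P' ⊆ R ∧ R' ⊆ R then (1 : ZMod 2) else 0))
      = ∑ R' ∈ W.powerset, ∑ S ∈ W.powerset,
          (if F.lab R' = 0 ∧ R' ⊆ W \ P ∧ F.lab S = F.lab P' ∧ P' ⊆ S ∧ R' ⊆ S then (1 : ZMod 2) else 0) by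
    refine sum_congr rfl fun R' hR' => ?_
    by_cases h0 : F.lab R' = 0 ∧ R' ⊆ W \ P
    · have := hc R' hR' h0.1
      rw [show (∑ R ∈ W.powerset, (if F.lab R' = 0 ∧ R' ⊆ W \ P ∧ F.lab R = 4 ∧ P' ⊆ R ∧ R' ⊆ R then (1 : ZMod 2) else 0))
          = ∑ R ∈ W.powerset, (if F.lab R = 4 ∧ P' ⊆ R ∧ R' ⊆ R then (1 : ZMod 2) else 0) from
        sum_congr rfl fun R _ => by simp only [h0, true_and],
        this]
      exact sum_congr rfl fun S _ => by simp only [h0, true_and]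
    · rw [sum_congr rfl fun R _ => if_neg fun h => h0 ⟨h.1, h.2.1⟩,
        sum_congr rfl fun S _ => if_neg fun h => h0 ⟨h.1, h.2.1⟩]]
  -- (d) exchange: the `R'`-sum counts the subsets of `S ∖ P` (all bottom: no rival of `P`), odd iff `S ⊆ P`
  rw [Finset.sum_comm]
  have hd : ∀ S ∈ W.powerset,
      (∑ R' ∈ W.powerset, (if F.lab R' = 0 ∧ R' ⊆ W \ P ∧ F.lab S = F.lab P' ∧ P' ⊆ S ∧ R' ⊆ S then (1 : ZMod 2) else 0))
        = if F.lab S = F.lab P' ∧ P' ⊆ S ∧ S ⊆ P then 1 else 0 := by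
    intro S hS
    have hSW : S ⊆ W := mem_powerset.1 hS
    by_cases h1 : F.lab S = F.lab P' ∧ P' ⊆ S
    · rw [show (if F.lab S = F.lab P' ∧ P' ⊆ S ∧ S ⊆ P then (1 : ZMod 2) else 0)
          = if (∅ : Finset α) = S \ P then 1 else 0 by
        by_cases h2 : S ⊆ P
        · rw [if_pos ⟨h1.1, h1.2, h2⟩, if_pos (Finset.sdiff_eq_empty_iff_subset.2 h2).symm]
        · rw [if_neg fun h => h2 h.2.2, if_neg fun h => h2 (Finset.sdiff_eq_empty_iff_subset.1 h.symm)]]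
      rw [← HallGladkov.sum_powerset_ite_Icc (A := ∅) (B := S \ P) (W := W) (sdiff_subset.trans hSW)]
      refine sum_congr rfl fun R' _ => ?_
      by_cases h3 : R' ⊆ S \ P
      · have hR'S : R' ⊆ S := h3.trans sdiff_subset
        have hR'WP : R' ⊆ W \ P := fun x hx => mem_sdiff.2 ⟨hSW (mem_sdiff.1 (h3 hx)).1, (mem_sdiff.1 (h3 hx)).2⟩
        -- `lab R' = 0`: it is `lab S = 1` or `0`, and not `1` (no rival of `P` inside `W ∖ P`)
        have hS1 : F.lab S = 1 := h1.1.trans hP'1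
        have hl0 : F.lab R' = 0 := by
          rcases F.lab_subset hR'S (by rw [hS1]; decide) with hRS | hR0
          · exact absurd (hRS.trans hS1) (hriv R' hR'WP)
          · exact hR0
        rw [if_pos ⟨hl0, hR'WP, h1.1, h1.2, hR'S⟩, if_pos ⟨empty_subset _, h3⟩]
      · rw [if_neg fun h => h3 (fun x hx => mem_sdiff.2 ⟨h.2.2.2.2 hx, (mem_sdiff.1 (h.2.1 hx)).2⟩), if_neg fun h => h3 h.2]
    · rw [if_neg fun h => h1 ⟨h.1, h.2.1⟩]
      exact sum_eq_zero fun R' _ => if_neg fun h => h1 ⟨h.2.2.1, h.2.2.2.1⟩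
  rw [sum_congr rfl hd]
  -- (e) the interval `[P', P]`: all its elements have label `1`; its size is odd iff `P' = P`
  have hP_W : P ⊆ W := hP
  rw [show (∑ S ∈ W.powerset, (if F.lab S = F.lab P' ∧ P' ⊆ S ∧ S ⊆ P then (1 : ZMod 2) else 0))
      = ∑ S ∈ W.powerset, (if P' ⊆ S ∧ S ⊆ P then (1 : ZMod 2) else 0) from
    sum_congr rfl fun S _ => by
      by_cases h : P' ⊆ S ∧ S ⊆ P
      · have hl : F.lab S = F.lab P' := by
          rcases F.lab_superset h.1 hc0 with hl | hl
          · exact hl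
          · exact absurd (F.lab_eq_four_of_subset h.2 hl) (by rw [hP1]; decide)
        rw [if_pos ⟨hl, h⟩, if_pos h]
      · rw [if_neg fun h' => h h'.2, if_neg h]]
  rw [HallGladkov.sum_powerset_ite_Icc (A := P') (B := P) (W := W) hP_W]
  by_cases h : P = P'
  · rw [if_pos h, if_pos h.symm]
  · rw [if_neg h, if_neg (Ne.symm h)]

/-! ## Reading `rbVec` with the complement row -/

/-- **READING `rbVec` WITH THE COMPLEMENT ROW** (this work).  For a rainbow `ρ = (Q1,Q2)` (`Q3 = (Q1∪Q2)ᶜ`), a bottom set `S` and a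
`(1|4)` set `P'` of the cube `Sᶜ` (`lab P' = 1`, `lab (Sᶜ ∖ P') = 4`) with no label-1 set inside `Sᶜ ∖ P'`, the `M`-row functional of the
kernel set `Sᶜ ∖ P'` on the supplies with spectator `S` evaluates on `rbVec ρ` to `[TS-B coefficient of ρ at S] · [P' = Q1]`. [this work] -/
theorem rbVec_read_compl {ρ : Finset α × Finset α} (hρ : ρ ∈ F.dem) (hr : F.IsRainbow ρ) {S P' : Finset α}
    (hS0 : F.lab S = 0) (hP'S : P' ⊆ Sᶜ) (hP'1 : F.lab P' = 1) (hriv : ∀ D, D ⊆ Sᶜ \ P' → F.lab D ≠ 1) :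
    (∑ σ ∈ F.sup, (if σ.2 = S then
        (∑ R' ∈ (Sᶜ).powerset, (if F.lab R' = 0 ∧ (σ.1 ∪ σ.2)ᶜ ⊆ R' ∧ R' ⊆ Sᶜ \ P' then (1 : ZMod 2) else 0)) * F.rbVec ρ σ
        else 0))
      = if F.lab S = 0 ∧ S ⊆ (ρ.1 ∪ ρ.2)ᶜ ∧ F.lab (Sᶜ \ ρ.1) = 4 then
          (∑ R' ∈ (Finset.univ : Finset α).powerset, (if F.lab R' = 0 ∧ S ⊆ R' ∧ R' ⊆ (ρ.1 ∪ ρ.2)ᶜ then (1 : ZMod 2) else 0)) *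
          (if P' = ρ.1 then 1 else 0)
        else 0 := by
  obtain ⟨-, hQ1, -, -⟩ := F.dem_rainbow_facts hρ hr
  rw [F.sum_sup_spectator S (Or.inr hS0)]
  by_cases hcond : F.lab S = 0 ∧ S ⊆ (ρ.1 ∪ ρ.2)ᶜ ∧ F.lab (Sᶜ \ ρ.1) = 4
  · have hPW : ρ.1 ⊆ Sᶜ := by
      intro x hx; rw [mem_compl]; intro hxS
      have := hcond.2.1 hxS; rw [mem_compl, mem_union, not_or] at this; exact this.1 hx
    have hc0 : F.lab (Sᶜ \ ρ.1) ≠ 0 := by rw [hcond.2.2]; decide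
    have key := F.nu_read_compl Sᶜ (P := P') (P' := ρ.1) hP'S hP'1 hQ1 hc0 hriv
    rw [← Finset.sum_filter_add_sum_filter_not (Sᶜ).powerset (fun O => F.lab O = 0 ∧ F.lab (Sᶜ \ O) = 4)] at key
    rw [show (∑ O ∈ (Sᶜ).powerset.filter (fun O => ¬ (F.lab O = 0 ∧ F.lab (Sᶜ \ O) = 4)),
          (∑ R' ∈ (Sᶜ).powerset, (if F.lab R' = 0 ∧ O ⊆ R' ∧ R' ⊆ Sᶜ \ P' then (1 : ZMod 2) else 0)) *
          (∑ R ∈ (Sᶜ).powerset, (if F.lab R = 4 ∧ ρ.1 ⊆ R ∧ R ⊆ Sᶜ \ O then (1 : ZMod 2) else 0))) = 0 from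
        sum_eq_zero fun O hO => by
          have hO' := (mem_filter.1 hO).2
          by_cases h0 : F.lab O = 0
          · have h4 : F.lab (Sᶜ \ O) ≠ 4 := fun h => hO' ⟨h0, h⟩
            rw [show (∑ R ∈ (Sᶜ).powerset, (if F.lab R = 4 ∧ ρ.1 ⊆ R ∧ R ⊆ Sᶜ \ O then (1 : ZMod 2) else 0)) = 0 from
              sum_eq_zero fun R _ => if_neg fun h' => h4 (F.lab_eq_four_of_subset h'.2.2 h'.1), mul_zero]
          · rw [F.crossM_eq_zero_of_lab_ne Sᶜ h0, zero_mul], add_zero] at key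
    rw [if_pos hcond]
    rw [show (∑ O ∈ (Sᶜ).powerset.filter (fun O => F.lab O = 0 ∧ F.lab (Sᶜ \ O) = 4),
            (∑ R' ∈ (Sᶜ).powerset, (if F.lab R' = 0 ∧ ((Sᶜ \ O) ∪ S)ᶜ ⊆ R' ∧ R' ⊆ Sᶜ \ P' then (1 : ZMod 2) else 0)) *
              F.rbVec ρ (Sᶜ \ O, S))
        = (∑ R' ∈ (Finset.univ : Finset α).powerset, (if F.lab R' = 0 ∧ S ⊆ R' ∧ R' ⊆ (ρ.1 ∪ ρ.2)ᶜ then (1 : ZMod 2) else 0)) *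
          (∑ O ∈ (Sᶜ).powerset.filter (fun O => F.lab O = 0 ∧ F.lab (Sᶜ \ O) = 4),
            (∑ R' ∈ (Sᶜ).powerset, (if F.lab R' = 0 ∧ O ⊆ R' ∧ R' ⊆ Sᶜ \ P' then (1 : ZMod 2) else 0)) *
            (∑ R ∈ (Sᶜ).powerset, (if F.lab R = 4 ∧ ρ.1 ⊆ R ∧ R ⊆ Sᶜ \ O then (1 : ZMod 2) else 0))) from ?_]
    · rw [key]
    rw [Finset.mul_sum]
    refine sum_congr rfl fun O hO => ?_
    have hOW : O ⊆ Sᶜ := mem_powerset.1 (mem_filter.1 hO).1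
    have h3 : ((Sᶜ \ O) ∪ S)ᶜ = O := third_of_mk hOW
    unfold rbVec
    simp only
    rw [h3, if_pos hcond, if_neg (fun h => by rw [hS0] at h; exact absurd h.1 (by decide)), add_zero]
    ring
  · rw [if_neg hcond]
    refine sum_eq_zero fun O _ => ?_
    unfold rbVec
    simp only
    rw [if_neg hcond, if_neg (fun h => by rw [hS0] at h; exact absurd h.1 (by decide)), add_zero, mul_zero]

end Sunflower

end Summit.CriticalPhenomena.PercolationContinuityZ3.Theorems.SunflowerPartition
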